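import Literature.Barriers.RiemannHypothesis.BerryKeatingOperator
import Literature.NumberTheory.LFunctions.ZetaArgVariation
import HarnessLib

/-!
# Discharge of the barrier `BerryKeatingOperator` (Endres–Steiner 2010, §2 and Thm. 15.6)

Sibling of `Literature/Barriers/RiemannHypothesis/BerryKeatingOperator.lean`, whose catalogued
named fact `Literature.Barriers.RiemannHypothesis.BerryKeatingOperator` — (i) the Weyl-ordered
`H_BK = −i(x d/dx + ½)` on `L²(ℝ_>, dx)` has no square-integrable eigenfunction (ES §2, (2.6)–(2.9));
(ii) no counting function with a linear Weyl law `N(k) ∼ a k` (ES Thm. 15.4–15.5: every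
self-adjoint realization of `H_BK`, resp. `H_BK²`, on a compact metric graph) is the zeta zero
count `N_ζ(T)`, indeed `N(T) < N_ζ(T)` for all large `T` (the comparison step of ES Thm. 15.6,
"No-go theorem") — is proved there from the Riemann–von Mangoldt formula as
`BerryKeatingOperator_of_riemann_von_mangoldt (h : Literature.riemann_von_mangoldt)`, part (i) outright
(`halfLine_eigenfunction_eq_zero`). The Riemann–von Mangoldt formula
`N(T) = (T/2π) log(T/2π) − T/2π + O(log T)` is PROVED in the tree
(`Literature.NumberTheory.LFunctions.riemann_von_mangoldt_holds`, `Literature/NumberTheory/LFunctions/ZetaArgVariation.lean`: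
argument principle for `ξ` on a rectangle, Backlund's bound `S(T) = O(log T)` via Jensen, and
Stirling for `θ`); this file only records the resulting unconditional discharge, kept in a sibling
so that the barrier's statement file does not import the zero-counting proofs.

## References

* [EndresSteiner2010] S. Endres, F. Steiner, *The Berry–Keating operator on `L²(ℝ_>, dx)` and on
  compact quantum graphs with general self-adjoint realizations*, J. Phys. A 43 (2010) 095204;
  arXiv:0912.3183 — abstract; §2 pp. 4–5, (2.6)–(2.9); p. 22, Thms. 15.4, 15.5, 15.6.
* E. C. Titchmarsh, *The Theory of the Riemann Zeta-Function*, 2nd ed. (1986), Thm. 9.4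
  (Riemann–von Mangoldt), via `Literature.NumberTheory.LFunctions.riemann_von_mangoldt_holds`.
-/

noncomputable section

open Filter

namespace Literature.Barriers.RiemannHypothesis

/-- **Discharge of the barrier `BerryKeatingOperator`** (Endres–Steiner 2010): (i) every classical
solution of `H_BK ψ = kψ` (`k ∈ ℝ`) on `(0, ∞)` lying in `L²(0, ∞)` vanishes identically; (ii) every
counting function with a linear Weyl law is eventually strictly below the zeta zero count
`N_ζ(T) = Literature.zetaZeroCount T` ("Neither `H_BK` nor `H_BK²` yields as eigenvalues the nontrivial
Riemann zeros if these are self-adjoint realizations on any compact graph", Thm. 15.6).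
Unconditional: `BerryKeatingOperator_of_riemann_von_mangoldt` fed with the tree's proof
`Literature.NumberTheory.LFunctions.riemann_von_mangoldt_holds` of the Riemann–von Mangoldt formula.
[cite: EndresSteiner2010, §2 (2.6)–(2.9) and Thm. 15.6] -/
theorem BerryKeatingOperator_holds : BerryKeatingOperator :=
  BerryKeatingOperator_of_riemann_von_mangoldt Literature.NumberTheory.LFunctions.riemann_von_mangoldt_holds

/-- `N_ζ(T)/T → ∞` unconditionally (Riemann–von Mangoldt), the growth fact behind (ii).
[cite: Titchmarsh1986, Thm. 9.4] -/
theorem tendsto_zetaZeroCount_div_atTop_holds :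
    Tendsto (fun T : ℝ ↦ (Literature.NumberTheory.LFunctions.zetaZeroCount T : ℝ) / T) atTop atTop :=
  tendsto_zetaZeroCount_div_atTop Literature.NumberTheory.LFunctions.riemann_von_mangoldt_holds

/-- (ii) in the "not the zeta count" form, unconditionally: a counting function with a linear Weyl
law `N(k)/k → a` (ES Thm. 15.5: `a = 𝔏/π` for every self-adjoint realization `(H_BK; A, B)` on a
compact metric graph of total length `𝔏`; Thm. 15.4 for `H_BK²` in the wave number) does not agree
with `N_ζ` for all large `T`. [cite: EndresSteiner2010, Thm. 15.5 and Thm. 15.6] -/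
theorem not_eventuallyEq_zetaZeroCount_of_hasLinearWeylLaw {N : ℝ → ℝ} {a : ℝ}
    (hN : HasLinearWeylLaw N a) : ¬ ∀ᶠ T in atTop, N T = Literature.NumberTheory.LFunctions.zetaZeroCount T :=
  BerryKeatingOperator_holds.not_eventuallyEq hN

section complexEigenvalues
open Set MeasureTheory Complex
/-- `|exp(s log x)|² = x^{2 Re s}` as a real power, for every complex `s`. [folklore] -/
theorem norm_exp_mul_log_sq_eq_rpow (s : ℂ) {x : ℝ} (hx : 0 < x) :
    ‖Complex.exp (s * (Real.log x : ℂ))‖ ^ 2 = x ^ (2 * s.re) := by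
  rw [Complex.norm_exp, Complex.mul_re, Complex.ofReal_re, Complex.ofReal_im, mul_zero, sub_zero,
    sq, ← Real.exp_add, Real.rpow_def_of_pos hx]
  congr 1
  ring

/-- **(i) for complex eigenvalues / arbitrary domains.** The differential expression
`H_BK = −i(x d/dx + ½)` has no nonzero square-integrable classical eigenfunction on `(0, ∞)` for
ANY complex eigenvalue `k`: the solutions are `ψ(1) x^{−1/2+ik}` with
`|x^{−1/2+ik}|² = x^{−1 − 2 Im k}`, never integrable on `(0, ∞)` (at `0` if `Im k ≥ 0`, at `∞` if
`Im k ≤ 0`). So no choice of domain or boundary condition — self-adjoint or not — makes a zeta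
zero an eigenvalue of `H_BK` itself on `L²(ℝ_>, dx)`; published `xp`-lines with eigenvalues
change the operator (non-unitary similarity transforms) or the space. [cite: EndresSteiner2010, §2 (2.6)–(2.9)] -/
theorem halfLine_eigenfunction_eq_zero_complex (k : ℂ) {ψ ψ' : ℝ → ℂ}
    (hd : ∀ x : ℝ, 0 < x → HasDerivAt ψ (ψ' x) x)
    (heig : ∀ x : ℝ, 0 < x → -I * ((x : ℂ) * ψ' x + ψ x / 2) = k * ψ x)
    (hL2 : IntegrableOn (fun x ↦ ‖ψ x‖ ^ 2) (Ioi 0)) : ∀ x, 0 < x → ψ x = 0 := by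
  set s : ℂ := -1 / 2 + k * I with hs_def
  have hODE : ∀ x : ℝ, 0 < x → (x : ℂ) * ψ' x = s * ψ x := by
    intro x hx
    have h1 : I * (-I * ((x : ℂ) * ψ' x + ψ x / 2)) = I * (k * ψ x) :=
      congrArg (fun z ↦ I * z) (heig x hx)
    rw [← mul_assoc, mul_neg, Complex.I_mul_I, neg_neg, one_mul] at h1
    rw [hs_def]
    linear_combination h1
  have hsol := eq_mul_exp_of_eulerODE hd hODE
  by_cases h1 : ψ 1 = 0
  · intro x hx
    rw [hsol x hx, h1, zero_mul]
  · exfalso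
    have hc : 0 < ‖ψ 1‖ ^ 2 := by positivity
    have hI1 : IntegrableOn (fun x : ℝ ↦ ‖ψ 1‖ ^ 2 * x ^ (2 * s.re)) (Ioi 0) := by
      refine hL2.congr_fun (fun x hx ↦ ?_) measurableSet_Ioi
      simp only
      rw [hsol x hx, norm_mul, mul_pow, norm_exp_mul_log_sq_eq_rpow s hx]
    have hI2 : IntegrableOn (fun x : ℝ ↦ x ^ (2 * s.re)) (Ioi 0) := by
      have h3 : IntegrableOn (fun x : ℝ ↦ (‖ψ 1‖ ^ 2)⁻¹ * (‖ψ 1‖ ^ 2 * x ^ (2 * s.re))) (Ioi 0) :=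
        hI1.const_mul ((‖ψ 1‖ ^ 2)⁻¹)
      refine h3.congr_fun (fun x _ ↦ ?_) measurableSet_Ioi
      show (‖ψ 1‖ ^ 2)⁻¹ * (‖ψ 1‖ ^ 2 * x ^ (2 * s.re)) = x ^ (2 * s.re)
      rw [← mul_assoc, inv_mul_cancel₀ hc.ne', one_mul]
    exact not_integrableOn_Ioi_rpow _ hI2

end complexEigenvalues

open Asymptotics in
/-- (ii) needs only linear GROWTH, not a linear Weyl LAW: if `N(T) = O(T)` then `N(T) < N_ζ(T)` for
all large `T` (given Riemann–von Mangoldt) — so the blocked class is "any operator whose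
eigenvalue count is `O(T)`", limits or not. [cite: EndresSteiner2010, Thm. 15.6] -/
theorem eventually_lt_zetaZeroCount_of_isBigO
    (h : Literature.NumberTheory.LFunctions.riemann_von_mangoldt) {N : ℝ → ℝ}
    (hN : N =O[atTop] fun T ↦ T) :
    ∀ᶠ T in atTop, N T < Literature.NumberTheory.LFunctions.zetaZeroCount T := by
  obtain ⟨C, hC⟩ := hN.bound
  have h2 : ∀ᶠ T in atTop, C + 1 < (Literature.NumberTheory.LFunctions.zetaZeroCount T : ℝ) / T :=
    (tendsto_zetaZeroCount_div_atTop h).eventually_gt_atTop (C + 1)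
  filter_upwards [hC, h2, eventually_gt_atTop 0] with T hT1 hT2 hT
  rw [lt_div_iff₀ hT] at hT2
  have hT1' : N T ≤ C * T := by
    calc N T ≤ ‖N T‖ := Real.le_norm_self _
      _ ≤ C * ‖T‖ := hT1
      _ = C * T := by rw [Real.norm_of_nonneg hT.le]
  nlinarith

open Asymptotics in
/-- Unconditionally: a counting function of at most linear growth is eventually below `N_ζ`.
[cite: EndresSteiner2010, Thm. 15.6] -/
theorem eventually_lt_zetaZeroCount_of_isBigO_holds {N : ℝ → ℝ} (hN : N =O[atTop] fun T ↦ T) :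
    ∀ᶠ T in atTop, N T < Literature.NumberTheory.LFunctions.zetaZeroCount T :=
  eventually_lt_zetaZeroCount_of_isBigO Literature.NumberTheory.LFunctions.riemann_von_mangoldt_holds hN

/-- **Discharge of the narrowed block `BerryKeatingOperatorNarrow`** (audit 2026-08-16): the
original barrier, closure of (ii) under finite sums, the linear Weyl law of every Egger–Steiner
layer `⌊T/(2πn)⌋`, the absence of one for their countable direct sum `N_ES = D(T/2π)`, and
`N_ES(T)/N_ζ(T) → 1` — unconditionally, from the tree's proof of Riemann–von Mangoldt.
[cite: EndresSteiner2010, §6 and Thm. 15.6] [cite: EggerSteiner2011, Introduction and §4 (11c)] -/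
theorem BerryKeatingOperatorNarrow_holds : BerryKeatingOperatorNarrow :=
  BerryKeatingOperatorNarrow_of_riemann_von_mangoldt
    Literature.NumberTheory.LFunctions.riemann_von_mangoldt_holds

/-- `N_ES(T)/N_ζ(T) → 1` unconditionally: the countable direct sum of linear-Weyl-law layers is
asymptotic to the zeta zero count. [cite: EggerSteiner2011, §4 (11c)] -/
theorem tendsto_esGraphCount_div_zetaZeroCount_holds :
    Tendsto (fun T : ℝ ↦ esGraphCount T /
      (Literature.NumberTheory.LFunctions.zetaZeroCount T : ℝ)) atTop (nhds 1) :=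
  tendsto_esGraphCount_div_zetaZeroCount Literature.NumberTheory.LFunctions.riemann_von_mangoldt_holds

end Literature.Barriers.RiemannHypothesis
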